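import Literature.NumberTheory.EllipticCurves.LocalIndexBadPoints
import HarnessLib

/-!
# Bad points of the non-split normal form: sums and parity

Computations with `K`-points of an equation `J` over a discrete valuation ring `R` in the
non-split normal form of `NonsplitNormalForm.lean` (`a₃ = a₄ = 0`, `a₆ ∈ 𝔪`, tangent form
`T² + ā₁T − ā₂` without roots in the residue field `k`), used by `NonsplitProofs.lean` to
prove `c_v = 1` or `2` for non-split multiplicative reduction (Silverman, *ATAEC*, IV.9.4
Step 2, PDF p. 344):

* `hasNonsingularReduction_add_of_anisotropic`: the sum of two points `(x₁, y₁)`, `(x₂, y₂)`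
  with `x₁, x₂ ∈ 𝔪` lies in `E₀(K)`: with `λ` the slope, either `v(λ) < 0` (reduction `𝒪`) or
  `λ ∈ R` and `x₃ = λ² + a₁λ − a₂ − x₁ − x₂` is a unit because `λ̄` is not a root of
  `T² + ā₁T − ā₂`. Hence `[E(K) : E₀(K)] ≤ 2`.
* `exists_eq_unit_mul_pow_of_anisotropic`: the form `Q(x, y) = y² + a₁xy − a₂x²` is
  anisotropic, `Q(x, y) = w·π^{2μ}` with `w ∈ Rˣ` and `π^μ ∣ x`.
* `not_equation_of_odd`: if `a₆ = απᵐ` with `α ∈ Rˣ` and `m` odd, no point `(x, y)` with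
  `x ∈ 𝔪` satisfies the equation `Q(x, y) = x³ + απᵐ` (comparison of `π`-adic orders), so
  `c_v = 1` when `v(Δ) = m` is odd.

## References

* J. H. Silverman, *Advanced Topics in the Arithmetic of Elliptic Curves*, GTM 151, Springer
  1994, IV.9.4 Step 2 (PDF p. 344) and its proof (PDF pp. 366–367). [SilvermanATAEC1994]
-/

noncomputable section

open scoped Classical

open IsLocalRing

namespace Literature.NumberTheory.EllipticCurves

namespace LocalIndex

open DiophantineGeometry DiophantineGeometry.TateAlgorithm

variable {R : Type*} [CommRing R] [IsDomain R] [IsDiscreteValuationRing R]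
  {K : Type*} [Field K] [Algebra R K] [IsFractionRing R K]

/-- **Bad points add up into `E₀` when the tangent form is anisotropic.** Let `a₃, a₄, a₆ ∈ 𝔪`
and suppose `T² + ā₁T − ā₂` has no root in the residue field. For integral points
`P₁ = (x₁, y₁)`, `P₂ = (x₂, y₂)` with `x₁, x₂ ∈ 𝔪`, `P₁ + P₂ ∈ E₀(K)`: if the slope `λ` has
`v(λ) < 0` the sum reduces to `𝒪`; otherwise `λ ∈ R` and `x₃ ≡ λ̄² + ā₁λ̄ − ā₂ ≠ 0`.
[cite: SilvermanATAEC1994, IV.9.4 Step 2] -/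
theorem hasNonsingularReduction_add_of_anisotropic (J : WeierstrassCurve R)
    (h3 : J.a₃ ∈ maximalIdeal R) (h4 : J.a₄ ∈ maximalIdeal R) (h6 : J.a₆ ∈ maximalIdeal R)
    (hani : ∀ τ : ResidueField R, τ ^ 2 + residue R J.a₁ * τ - residue R J.a₂ ≠ 0)
    {x₁ y₁ x₂ y₂ : R} (hx₁ : x₁ ∈ maximalIdeal R) (hx₂ : x₂ ∈ maximalIdeal R)
    (h₁ : (J.baseChange K).toAffine.Nonsingular (algebraMap R K x₁) (algebraMap R K y₁))
    (h₂ : (J.baseChange K).toAffine.Nonsingular (algebraMap R K x₂) (algebraMap R K y₂)) :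
    J.HasNonsingularReduction
      (WeierstrassCurve.Affine.Point.some _ _ h₁ + WeierstrassCurve.Affine.Point.some _ _ h₂) := by
  have hv := integers_valuationRing_valuation R K
  by_cases hxy : algebraMap R K x₁ = algebraMap R K x₂ ∧
      algebraMap R K y₁ = (J.baseChange K).toAffine.negY (algebraMap R K x₂) (algebraMap R K y₂)
  · rw [WeierstrassCurve.Affine.Point.add_of_Y_eq hxy.1 hxy.2]; trivial
  rw [WeierstrassCurve.Affine.Point.add_some hxy]
  set L := (J.baseChange K).toAffine.slope (algebraMap R K x₁) (algebraMap R K x₂)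
    (algebraMap R K y₁) (algebraMap R K y₂) with hL
  by_cases hLv : 1 < ValuationRing.valuation R K L
  · exact Or.inl ((not_mem_range_iff hv).mpr
      (one_lt_v_addX_of_one_lt_v_slope hv (hv.map_le_one x₁) (hv.map_le_one x₂) hLv))
  obtain ⟨ℓ, hℓ⟩ := hv.exists_of_le_one (not_lt.mp hLv)
  have hX : (J.baseChange K).toAffine.addX (algebraMap R K x₁) (algebraMap R K x₂) L =
      algebraMap R K (ℓ ^ 2 + J.a₁ * ℓ - J.a₂ - x₁ - x₂) := by
    rw [WeierstrassCurve.Affine.addX, ← hℓ]; simp [WeierstrassCurve.baseChange]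
  refine hasNonsingularReduction_some_of_isUnit J h3 h4 h6 ?_ _ hX
  rw [isUnit_iff_residue_ne_zero]
  simp only [map_sub, map_add, map_pow, map_mul, (residue_eq_zero_iff _).mpr hx₁,
    (residue_eq_zero_iff _).mpr hx₂, sub_zero]
  exact hani _

/-- **Anisotropy of the tangent form.** If `T² + ā₁T − ā₂` has no root in the residue field,
then for `(x, y) ≠ (0, 0)` in `R²`, `y² + a₁xy − a₂x² = w·π^{2μ}` with `w ∈ Rˣ` and `π^μ ∣ x`
(`μ = min(v(x), v(y))`: after dividing by `π^{2μ}` one coordinate is a unit, and the reduced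
value `ȳ'² + ā₁x̄'ȳ' − ā₂x̄'²` vanishes only at `(0, 0)`). [folklore] -/
theorem exists_eq_unit_mul_pow_of_anisotropic (J : WeierstrassCurve R) {ϖ : R}
    (hϖ : Irreducible ϖ)
    (hani : ∀ τ : ResidueField R, τ ^ 2 + residue R J.a₁ * τ - residue R J.a₂ ≠ 0)
    {x y : R} (hxy : x ≠ 0 ∨ y ≠ 0) :
    ∃ (μ : ℕ) (w : Rˣ), y ^ 2 + J.a₁ * x * y - J.a₂ * x ^ 2 = ↑w * ϖ ^ (2 * μ) ∧ ϖ ^ μ ∣ x := by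
  have hres0 : residue R ϖ = 0 :=
    (residue_eq_zero_iff _).mpr ((IsLocalRing.mem_maximalIdeal _).mpr hϖ.not_isUnit)
  have ha₂ : residue R J.a₂ ≠ 0 := by
    intro h0; apply hani 0; rw [h0]; ring
  -- the generic step: `Q(u ϖ^a, v ϖ^b)` with `u` a unit and `a = 0`, or `v` a unit and `b = 0`
  have hunit : ∀ (p q : R), (IsUnit p ∨ (IsUnit q ∧ p ∈ maximalIdeal R)) →
      IsUnit (q ^ 2 + J.a₁ * p * q - J.a₂ * p ^ 2) := by
    rintro p q (hp | ⟨hq, hp⟩)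
    · rw [isUnit_iff_residue_ne_zero] at hp ⊢
      intro h0
      apply hani (residue R q / residue R p)
      simp only [map_sub, map_add, map_pow, map_mul] at h0
      field_simp
      linear_combination h0
    · rw [isUnit_iff_residue_ne_zero] at hq ⊢
      simp only [map_sub, map_add, map_pow, map_mul, (residue_eq_zero_iff _).mpr hp, mul_zero,
        zero_mul, add_zero, sub_zero, ne_eq, zero_pow two_ne_zero]
      exact pow_ne_zero 2 hq
  by_cases hx0 : x = 0
  · subst hx0
    have hy0 : y ≠ 0 := hxy.resolve_left (fun h => h rfl)
    obtain ⟨j, v, hv⟩ := IsDiscreteValuationRing.eq_unit_mul_pow_irreducible hy0 hϖ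
    refine ⟨j, v ^ 2, ?_, dvd_zero _⟩
    rw [hv, Units.val_pow_eq_pow_val]; ring
  obtain ⟨i, u, hu⟩ := IsDiscreteValuationRing.eq_unit_mul_pow_irreducible hx0 hϖ
  by_cases hy0 : y = 0
  · subst hy0
    have hw : IsUnit (-J.a₂ * ↑u ^ 2) := by
      rw [isUnit_iff_residue_ne_zero, map_mul, map_neg, map_pow]
      exact mul_ne_zero (neg_ne_zero.mpr ha₂) (pow_ne_zero 2 ((isUnit_iff_residue_ne_zero _).mp
        u.isUnit))
    refine ⟨i, hw.unit, ?_, hu ▸ Dvd.intro_left _ rfl⟩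
    rw [hw.unit_spec, hu]; ring
  obtain ⟨j, v, hv⟩ := IsDiscreteValuationRing.eq_unit_mul_pow_irreducible hy0 hϖ
  rcases le_or_gt i j with hij | hji
  · -- `μ = i`
    obtain ⟨c, rfl⟩ : ∃ c, j = i + c := ⟨j - i, by omega⟩
    have hw := hunit (↑u) (↑v * ϖ ^ c) (Or.inl u.isUnit)
    refine ⟨i, hw.unit, ?_, hu ▸ Dvd.intro_left _ rfl⟩
    rw [hw.unit_spec, hu, hv]; ring
  · -- `μ = j < i`
    obtain ⟨c, rfl⟩ : ∃ c, i = j + (c + 1) := ⟨i - j - 1, by omega⟩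
    have hw := hunit (↑u * ϖ ^ (c + 1)) (↑v) (Or.inr ⟨v.isUnit, Ideal.mul_mem_left _ _
      (Ideal.pow_mem_of_mem _ ((IsLocalRing.mem_maximalIdeal _).mpr hϖ.not_isUnit) _
        (Nat.succ_pos c))⟩)
    refine ⟨j, hw.unit, ?_, ?_⟩
    · rw [hw.unit_spec, hu, hv]; ring
    · rw [hu]; exact Dvd.intro (↑u * ϖ ^ (c + 1)) (by ring)

/-- **No bad point when `v(a₆)` is odd.** In the non-split normal form (`a₃ = a₄ = 0`,
anisotropic tangent form) with `a₆ = απᵐ`, `α ∈ Rˣ`, `m` odd, the equation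
`y² + a₁xy − a₂x² = x³ + απᵐ` has no solution with `x ∈ 𝔪`: the left side has even order
`2μ ≤ 2v(x)`, the right side has order `m` (if `3v(x) > m`), `3v(x)` (if `3v(x) < m`) or
`≥ m = 3v(x) > 2v(x)`. This is "`c = 1` if `v(Δ)` is odd" of Silverman, *ATAEC*, IV.9.4 Step 2.
[cite: SilvermanATAEC1994, IV.9.4 Step 2] -/
theorem not_equation_of_odd (J : WeierstrassCurve R) {ϖ : R} (hϖ : Irreducible ϖ)
    (h3 : J.a₃ = 0) (h4 : J.a₄ = 0) {α : R} (hα : IsUnit α) {m : ℕ} (hm : Odd m)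
    (h6 : J.a₆ = α * ϖ ^ m)
    (hani : ∀ τ : ResidueField R, τ ^ 2 + residue R J.a₁ * τ - residue R J.a₂ ≠ 0)
    {x y : R} (hx : x ∈ maximalIdeal R) (he : J.toAffine.Equation x y) : False := by
  have hϖ0 : ϖ ≠ 0 := hϖ.ne_zero
  rw [WeierstrassCurve.Affine.equation_iff, h3, h4, h6] at he
  have he' : y ^ 2 + J.a₁ * x * y - J.a₂ * x ^ 2 = x ^ 3 + α * ϖ ^ m := by linear_combination he
  have hxy : x ≠ 0 ∨ y ≠ 0 := by
    by_contra h0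
    push Not at h0
    obtain ⟨rfl, rfl⟩ := h0
    have : α * ϖ ^ m = 0 := by linear_combination -he'
    exact hα.ne_zero ((mul_eq_zero.mp this).resolve_right (pow_ne_zero _ hϖ0))
  obtain ⟨μ, w, hQ, hμx⟩ := exists_eq_unit_mul_pow_of_anisotropic J hϖ hani hxy
  rw [hQ] at he'
  -- compare orders in `w ϖ^(2μ) = x³ + α ϖ^m`
  by_cases hx0 : x = 0
  · subst hx0
    have hcmp : (↑w : R) * ϖ ^ (2 * μ) = ↑hα.unit * ϖ ^ m := by rw [hα.unit_spec, he']; ring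
    have := IsDiscreteValuationRing.unit_mul_pow_congr_pow hϖ hϖ _ _ _ _ hcmp
    exact (Nat.not_even_iff_odd.mpr hm) ⟨μ, by omega⟩
  obtain ⟨i, u, hu⟩ := IsDiscreteValuationRing.eq_unit_mul_pow_irreducible hx0 hϖ
  have hi : 1 ≤ i := by
    refine Nat.one_le_iff_ne_zero.mpr fun h0 => ?_
    rw [h0, pow_zero, mul_one] at hu
    exact (IsLocalRing.mem_maximalIdeal _).mp hx (hu ▸ u.isUnit)
  have hμi : μ ≤ i := by
    rw [hu, IsUnit.dvd_mul_left u.isUnit, pow_dvd_pow_iff hϖ0 hϖ.not_isUnit] at hμx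
    exact hμx
  rcases lt_trichotomy (3 * i) m with hlt | heq | hgt
  · -- `3 i < m`: order `3 i = 2 μ ≤ 2 i`
    obtain ⟨c, hc⟩ : ∃ c, m = 3 * i + (c + 1) := ⟨m - 3 * i - 1, by omega⟩
    have hw' : IsUnit ((↑u : R) ^ 3 + ϖ * (α * ϖ ^ c)) :=
      isUnit_add_mul_of_isUnit hϖ (u.isUnit.pow 3) _
    have hcmp : (↑w : R) * ϖ ^ (2 * μ) = ↑hw'.unit * ϖ ^ (3 * i) := by
      rw [hw'.unit_spec, he', hu, hc]; ring
    have := IsDiscreteValuationRing.unit_mul_pow_congr_pow hϖ hϖ _ _ _ _ hcmp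
    omega
  · -- `3 i = m`
    by_cases hw' : IsUnit ((↑u : R) ^ 3 + α)
    · have hcmp : (↑w : R) * ϖ ^ (2 * μ) = ↑hw'.unit * ϖ ^ m := by
        rw [hw'.unit_spec, he', hu, ← heq]; ring
      have := IsDiscreteValuationRing.unit_mul_pow_congr_pow hϖ hϖ _ _ _ _ hcmp
      omega
    · obtain ⟨c, hc⟩ := (mem_maximalIdeal_iff_dvd_of_irreducible hϖ _).mp
        ((IsLocalRing.mem_maximalIdeal _).mpr hw')
      have hdvd : ϖ ^ (m + 1) ∣ ϖ ^ (2 * μ) := by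
        refine (w.isUnit.dvd_mul_left).mp ⟨c, ?_⟩
        rw [he', hu, ← heq, show (↑u * ϖ ^ i) ^ 3 + α * ϖ ^ (3 * i) = ϖ ^ (3 * i) * (↑u ^ 3 + α)
          by ring, hc]; ring
      have := (pow_dvd_pow_iff hϖ0 hϖ.not_isUnit).mp hdvd
      omega
  · -- `3 i > m`: order `m = 2 μ`, `m` even
    obtain ⟨c, hc⟩ : ∃ c, 3 * i = m + (c + 1) := ⟨3 * i - m - 1, by omega⟩
    have hw' : IsUnit (α + ϖ * (↑u ^ 3 * ϖ ^ c)) := isUnit_add_mul_of_isUnit hϖ hα _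
    have hcmp : (↑w : R) * ϖ ^ (2 * μ) = ↑hw'.unit * ϖ ^ m := by
      rw [hw'.unit_spec, he', hu]
      calc (↑u * ϖ ^ i) ^ 3 + α * ϖ ^ m = ↑u ^ 3 * ϖ ^ (3 * i) + α * ϖ ^ m := by ring
        _ = _ := by rw [hc]; ring
    have := IsDiscreteValuationRing.unit_mul_pow_congr_pow hϖ hϖ _ _ _ _ hcmp
    exact (Nat.not_even_iff_odd.mpr hm) ⟨μ, by omega⟩

end LocalIndex

end Literature.NumberTheory.EllipticCurves

end
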